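/-
Copyright: b2b-lace packet (certified numerics seat 3 / enumeration lane, gen 9).  The ℕ-CODED form of the
end-bond recursion for trail counts (`TrailCountRecursion`), evaluable by the kernel, and the TRANSFER
THEOREM `a_n(y; E) = Σ_j trailCode n j m (code y) ‖y‖₁ L · 2^j (d-m)^{(j)}`: one kernel evaluation per
(length, class, number of fresh coordinates) gives the count in EVERY dimension `d`.  The point coding and
all its lemmas are those of `SawCountKernel`; new is only the coding of the traversed BONDS.  No cell of the
record is touched; no fact; no `sorry`.
-/
import Literature.Probability.FitznerVanDerHofstad2017.TrailCountRecursion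
import Literature.Probability.FitznerVanDerHofstad2017.SawCountKernel
import HarnessLib

/-!
# A kernel-evaluable coding of the trail end-bond recursion, uniform in the dimension

CITATION HEADER (PLACEMENT v2). This module is part of a certified REPRODUCTION of:
R. Fitzner, R. van der Hofstad, *Mean-field behavior for nearest-neighbor percolation in d > 10*,
Electron. J. Probab. 22 (2017), no. 43 [FvdH17]; *Generalized approach to the non-backtracking lace
expansion*, Probab. Theory Related Fields 169 (2017) [NoBLE17-I] (arXiv:1506.07977, 1506.07969).
Reproduces: the notebook input `nrBAW[n,d,x]` (SRW.nb §3: "number of … bond-avoiding walks (BAW) with a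
specific number of steps", polynomials in `d`; = the trail counts `a_n(x)` of [NoBLE17-I] §5.3.1).  Here: the
MACHINE.  `TrailCountTables` holds the kernel-evaluated numbers.

## The coding

Points are coded exactly as in `SawCountKernel` (`code D y = Σ_{i<D} (y_i + 32) 64^i`, `‖y‖₁` carried
along, `m` active coordinates, `j` fresh coordinates owed, each entered canonically — justified by the
fresh-dimension collapse `TrailCountRecursion.trailCount_succ_of_suppBelow`).  A traversed BOND `{z, z + e_i}`
is coded by `bondCode (code D z) i = code(z) · 64 + i` (lower end point and direction), the set of traversed
bonds by the list of these codes.  `trailCode n j m c l1 L` runs `TrailCountRecursion.trailCount` on codes;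
the transfer theorem **`trailCount_eq_sum_trailCode`** states, for `y`, `E` supported on the first `m ≤ d`
coordinates inside the box,
`trailCount d n y E = Σ_{j ≤ n} trailCode n j m (code D y) ‖y‖₁ L · (2^j · (d-m)(d-m-1)⋯(d-m-j+1))`, whence
**`card_trailWordsTo_eq_sum_trailCode`**: `#trailWordsTo d n x = Σ_{j ≤ n} N_j · 2^j (d-s)^{(j)}` for `x`
supported on the first `s ≤ d` coordinates, with `N_j = trailCode n j s (code (s+n) x) ‖x‖₁ []` INDEPENDENT
of `d` — the notebook's "polynomial in d" for `nrBAW`, coefficient by coefficient, each `N_j` one `decide`.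
The kernel runs the variant `trailCodeF` (primitive `Nat.blt/ble/beq` tests, the hashed membership filter of
`SawCountKernel.memF`, no still-born children; **`trailCodeF_eq`**, `trailCode_eq_trailCodeF`).

## What is NOT here

No numeral table (see `TrailCountTables`), no dimension fixed, no cell, no fact, no `sorry`.

## References
* N. Madras, G. Slade, The Self-Avoiding Walk (1993), §1.2 [folklore recursion for walks with a bond
  constraint].
* R. Fitzner, R. van der Hofstad, SRW.nb (2015) §3 (`nrBAW`), arXiv:1506.07977 anc.; [NoBLE17-I] §5.3.1
  pp. 1096–1097 (the table reproduced downstream).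
-/

namespace Literature.Probability.FitznerVanDerHofstad2017

open Finset Literature.Probability.LatticeModels Literature.Probability.Percolation

variable {d : ℕ}

/-! ### The coded recursion (kernel side: only `ℕ`, `Bool`, `List ℕ`) -/

/-- The code of the bond `{z, z + e_i}` from the code `c` of its lower end point `z` and its direction `i`:
`c · sawB + i`. [folklore] -/
def bondCode (c i : ℕ) : ℕ := c * sawB + i

/-- Zero steps left: the trail must sit at the origin (`‖y‖₁ = 0`) with no fresh coordinate owed (sites may
be revisited, so there is no membership test). [folklore] -/
def trailBase (j _m _c l1 : ℕ) (_L : List ℕ) : ℕ :=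
  bif decide (j + l1 = 0) then 1 else 0

/-- One step of the coded recursion: prune (`n+1 < 2j + ‖y‖₁` or wrong parity), then the `2m` steps inside
the active coordinates — each rejected if its bond was traversed, else recorded — and (if a fresh coordinate
is still owed) the canonical step into coordinate `m` (its bond is new). [folklore] -/
def trailStep (n : ℕ) (rec : ℕ → ℕ → ℕ → ℕ → List ℕ → ℕ) (j m c l1 : ℕ) (L : List ℕ) : ℕ :=
  bif decide (n + 1 < 2 * j + l1 ∨ (n + 1 + l1) % 2 = 1) then 0 else
    stepSum m (fun i =>
      let g := digitAt c i
      (bif memL (bondCode c i) L then 0 else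
          rec j m (c + sawB ^ i) (bif decide (sawR ≤ g) then l1 + 1 else l1 - 1) (bondCode c i :: L)) +
        (bif memL (bondCode (c - sawB ^ i) i) L then 0 else
          rec j m (c - sawB ^ i) (bif decide (g ≤ sawR) then l1 + 1 else l1 - 1)
            (bondCode (c - sawB ^ i) i :: L))) +
    (match j with
      | 0 => 0
      | j' + 1 => rec j' (m + 1) (c + sawB ^ m) (l1 + 1) (bondCode c m :: L))

/-- **The coded trail recursion** `trailCode n j m c l1 L`: number of `n`-step trail continuations from the
coded point `c` (with `‖·‖₁ = l1`, avoiding the coded bond set `L`, `m` active coordinates) to the origin that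
use exactly `j` fresh coordinates, each entered canonically. [folklore] -/
def trailCode : ℕ → ℕ → ℕ → ℕ → ℕ → List ℕ → ℕ
  | 0 => trailBase
  | n + 1 => trailStep n (trailCode n)

/-! ### Elementary properties of the coded side -/

/-- The prune is sound on ALL inputs: `trailCode n j m c l1 L = 0` if `n < 2j + l1` or `n + l1` is odd.
[folklore] -/
theorem trailCode_prune {n j m c l1 : ℕ} {L : List ℕ} (h : n < 2 * j + l1 ∨ (n + l1) % 2 = 1) :
    trailCode n j m c l1 L = 0 := by
  cases n with
  | zero =>
    simp only [trailCode, trailBase, Bool.cond_decide]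
    rw [if_neg (by omega)]
  | succ n =>
    simp only [trailCode, trailStep, Bool.cond_decide]
    rw [if_pos h]

/-- `trailCode_zero` (coding bookkeeping). [folklore] -/
theorem trailCode_zero (j m c l1 : ℕ) (L : List ℕ) : trailCode 0 j m c l1 L = if j + l1 = 0 then 1 else 0 := by
  simp only [trailCode, trailBase, Bool.cond_decide]

/-- `trailCode_succ` (coding bookkeeping): the unpruned step, unfolded. [folklore] -/
theorem trailCode_succ (n : ℕ) {j m c l1 : ℕ} {L : List ℕ}
    (hp : ¬ (n + 1 < 2 * j + l1 ∨ (n + 1 + l1) % 2 = 1)) :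
    trailCode (n + 1) j m c l1 L =
      (∑ i ∈ range m,
        ((if memL (bondCode c i) L = true then 0 else
            trailCode n j m (c + sawB ^ i) (if sawR ≤ digitAt c i then l1 + 1 else l1 - 1)
              (bondCode c i :: L)) +
          (if memL (bondCode (c - sawB ^ i) i) L = true then 0 else
            trailCode n j m (c - sawB ^ i) (if digitAt c i ≤ sawR then l1 + 1 else l1 - 1)
              (bondCode (c - sawB ^ i) i :: L)))) +
      (if j = 0 then 0 else trailCode n (j - 1) (m + 1) (c + sawB ^ m) (l1 + 1) (bondCode c m :: L)) := by
  simp only [trailCode, trailStep, Bool.cond_decide, if_neg hp, stepSum_eq_sum]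
  cases j <;> simp [Bool.cond_eq_ite]

/-! ### The fast variant: hashed membership filter and no still-born children

`trailCodeF` computes the same numbers as `trailCode` (theorem `trailCodeF_eq`) but (i) keeps, next to the
list `L` of bond codes, the bit mask `V` of their residues mod `sawP` (`SawCountKernel.memF`), and (ii) does
not spawn the outward steps that the prune would kill at once. -/

/-- Fast base case (cf. `trailBase`; primitive `Nat.beq`). [folklore] -/
def trailBaseF (j _m _c l1 _V : ℕ) (_L : List ℕ) : ℕ :=
  bif Nat.beq (j + l1) 0 then 1 else 0

/-- Fast step (cf. `trailStep`; primitive tests, filtered membership): an outward step is spawned only if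
`2j + ‖y‖₁ + 2 ≤ n + 1`. [folklore] -/
def trailStepF (n : ℕ) (rec : ℕ → ℕ → ℕ → ℕ → ℕ → List ℕ → ℕ) (j m c l1 V : ℕ) (L : List ℕ) : ℕ :=
  bif (Nat.blt (n + 1) (2 * j + l1) || Nat.beq ((n + 1 + l1) % 2) 1) then 0 else
    let away := Nat.ble (2 * j + l1 + 2) (n + 1)
    stepSum m (fun i =>
      let g := digitAt c i
      let bp := bondCode c i
      let bm := bondCode (c - sawB ^ i) i
      (bif (away || Nat.blt g sawR) then
          (bif memF bp V L then 0 else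
            rec j m (c + sawB ^ i) (bif Nat.ble sawR g then l1 + 1 else l1 - 1) (V ||| 2 ^ (bp % sawP))
              (bp :: L)) else 0) +
        (bif (away || Nat.blt sawR g) then
          (bif memF bm V L then 0 else
            rec j m (c - sawB ^ i) (bif Nat.ble g sawR then l1 + 1 else l1 - 1) (V ||| 2 ^ (bm % sawP))
              (bm :: L)) else 0)) +
    (match j with
      | 0 => 0
      | j' + 1 =>
        rec j' (m + 1) (c + sawB ^ m) (l1 + 1) (V ||| 2 ^ (bondCode c m % sawP)) (bondCode c m :: L))

/-- **The fast coded trail recursion** (what the kernel actually runs in `TrailCountTables`). [folklore] -/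
def trailCodeF : ℕ → ℕ → ℕ → ℕ → ℕ → ℕ → List ℕ → ℕ
  | 0 => trailBaseF
  | n + 1 => trailStepF n (trailCodeF n)

/-- One step of the fast recursion agrees with `trailCode (n+1)` whenever the recursive oracle `rec` agrees
with `trailCode n` under the filter invariant (shared by `trailCodeF_eq` and `trailCodeT_eq`). [folklore] -/
theorem trailStepF_eq (n : ℕ) (rec : ℕ → ℕ → ℕ → ℕ → ℕ → List ℕ → ℕ)
    (hrec : ∀ (j m c l1 V : ℕ) (L : List ℕ), FInv V L → rec j m c l1 V L = trailCode n j m c l1 L) :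
    ∀ (j m c l1 V : ℕ) (L : List ℕ), FInv V L → trailStepF n rec j m c l1 V L = trailCode (n + 1) j m c l1 L := by
  intro j m c l1 V L hV
  simp only [trailCode, trailStepF, trailStep, memF_eq hV, natBlt_eq_decide, natBle_eq_decide,
    natBeq_eq_decide, ← Bool.decide_or]
  cases decide (n + 1 < 2 * j + l1 ∨ (n + 1 + l1) % 2 = 1)
  · simp only [cond_false]
    congr 1
    · congr 1
      funext i
      congr 1
      · by_cases hb : 2 * j + l1 + 2 ≤ n + 1 ∨ digitAt c i < sawR
        · rw [decide_eq_true hb, cond_true]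
          cases memL (bondCode c i) L
          · exact hrec _ _ _ _ _ _ (hV.cons _)
          · rfl
        · rw [decide_eq_false hb, cond_false]
          cases memL (bondCode c i) L
          · rw [cond_false, trailCode_prune]
            rw [not_or] at hb
            left
            simp only [Bool.cond_decide]
            rw [if_pos (by omega)]
            omega
          · rfl
      · by_cases hb : 2 * j + l1 + 2 ≤ n + 1 ∨ sawR < digitAt c i
        · rw [decide_eq_true hb, cond_true]
          cases memL (bondCode (c - sawB ^ i) i) L
          · exact hrec _ _ _ _ _ _ (hV.cons _)
          · rfl
        · rw [decide_eq_false hb, cond_false]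
          cases memL (bondCode (c - sawB ^ i) i) L
          · rw [cond_false, trailCode_prune]
            rw [not_or] at hb
            left
            simp only [Bool.cond_decide]
            rw [if_pos (by omega)]
            omega
          · rfl
    · cases j
      · rfl
      · exact hrec _ _ _ _ _ _ (hV.cons _)
  · rfl

/-- **`trailCodeF = trailCode`** under the filter invariant (in particular `trailCodeF n j m c l1 0 [] =
trailCode n j m c l1 []`). [folklore] -/
theorem trailCodeF_eq (n : ℕ) :
    ∀ (j m c l1 V : ℕ) (L : List ℕ), FInv V L → trailCodeF n j m c l1 V L = trailCode n j m c l1 L := by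
  induction n with
  | zero =>
    intro j m c l1 V L hV
    simp only [trailCodeF, trailCode, trailBaseF, trailBase, natBeq_eq_decide]
  | succ n ih =>
    intro j m c l1 V L hV
    rw [show trailCodeF (n + 1) j m c l1 V L = trailStepF n (trailCodeF n) j m c l1 V L from rfl]
    exact trailStepF_eq n _ ih j m c l1 V L hV

/-- The closed form used by the tables: `trailCode n j m c l1 [] = trailCodeF n j m c l1 0 []`. [folklore] -/
theorem trailCode_eq_trailCodeF (n j m c l1 : ℕ) : trailCode n j m c l1 [] = trailCodeF n j m c l1 0 [] :=
  (trailCodeF_eq n j m c l1 0 [] fInv_nil).symm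

/-! ## Splitting a heavy evaluation: filter masks of bond lists and a one-level oracle

A single kernel evaluation (`decide +kernel`) of a large sub-tree can exceed the checker's resource cap; the
tables therefore certify heavy coefficients in pieces: the values of chosen sub-trees (recursion level `k`,
i.e. `k` steps left) are certified separately as `trailCode k … = v` facts, collected in an oracle table `T`,
and the root is evaluated by `trailCodeT k T`, which consults `T` at level `k` and otherwise runs `trailStepF`.
`trailCodeT_eq` says the result is `trailCode` whenever every entry of `T` is correct (`TValid`). -/

/-- Filter mask of a used-bond list (so that `FInv (maskOf L) L`). [folklore] -/
def maskOf : List ℕ → ℕ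
  | [] => 0
  | b :: L => maskOf L ||| 2 ^ (b % sawP)

/-- [folklore] -/
theorem fInv_maskOf : ∀ L : List ℕ, FInv (maskOf L) L
  | [] => fInv_nil
  | b :: L => (fInv_maskOf L).cons b

/-- Evaluating `trailCode` at an inner node by the fast recursion: `trailCode n … L = trailCodeF n … (maskOf L) L`.
[folklore] -/
theorem trailCode_eq_trailCodeF_maskOf (n j m c l1 : ℕ) (L : List ℕ) :
    trailCode n j m c l1 L = trailCodeF n j m c l1 (maskOf L) L :=
  (trailCodeF_eq n j m c l1 _ L (fInv_maskOf L)).symm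

/-- Boolean equality of lists of naturals (kernel-friendly). [folklore] -/
def listBeq : List ℕ → List ℕ → Bool
  | [], [] => true
  | a :: L, b :: M => Nat.beq a b && listBeq L M
  | _, _ => false

/-- [folklore] -/
theorem eq_of_listBeq : ∀ {L M : List ℕ}, listBeq L M = true → L = M
  | [], [], _ => rfl
  | [], _ :: _, h => by simp [listBeq] at h
  | _ :: _, [], h => by simp [listBeq] at h
  | a :: L, b :: M, h => by
    simp only [listBeq, Bool.and_eq_true] at h
    rw [Nat.eq_of_beq_eq_true h.1, eq_of_listBeq h.2]

/-- Oracle lookup: the value recorded in `T` for the state `(j, m, c, l1, L)`, if any (entries are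
`(j, m, c, l1, L, value)`). [folklore] -/
def lookT : List (ℕ × ℕ × ℕ × ℕ × List ℕ × ℕ) → ℕ → ℕ → ℕ → ℕ → List ℕ → Option ℕ
  | [], _, _, _, _, _ => none
  | (j', m', c', l1', L', v) :: T, j, m, c, l1, L =>
      bif (Nat.beq c c' && Nat.beq j j' && Nat.beq m m' && Nat.beq l1 l1' && listBeq L L') then some v
      else lookT T j m c l1 L

/-- [folklore] -/
theorem mem_of_lookT_eq_some {j m c l1 v : ℕ} {L : List ℕ} :
    ∀ {T : List (ℕ × ℕ × ℕ × ℕ × List ℕ × ℕ)}, lookT T j m c l1 L = some v → (j, m, c, l1, L, v) ∈ T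
  | [], h => by simp [lookT] at h
  | (j', m', c', l1', L', v') :: T, h => by
    unfold lookT at h
    cases hb : (Nat.beq c c' && Nat.beq j j' && Nat.beq m m' && Nat.beq l1 l1' && listBeq L L') with
    | false =>
      rw [hb, cond_false] at h
      exact List.mem_cons_of_mem _ (mem_of_lookT_eq_some h)
    | true =>
      rw [hb, cond_true, Option.some.injEq] at h
      simp only [Bool.and_eq_true] at hb
      obtain ⟨⟨⟨⟨hc, hj⟩, hm⟩, hl⟩, hL⟩ := hb
      rw [Nat.eq_of_beq_eq_true hc, Nat.eq_of_beq_eq_true hj, Nat.eq_of_beq_eq_true hm,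
        Nat.eq_of_beq_eq_true hl, eq_of_listBeq hL, ← h]
      exact List.mem_cons_self

/-- **Oracle-assisted fast recursion**: at level `k` the table `T` is consulted first. [folklore] -/
def trailCodeT (k : ℕ) (T : List (ℕ × ℕ × ℕ × ℕ × List ℕ × ℕ)) : ℕ → ℕ → ℕ → ℕ → ℕ → ℕ → List ℕ → ℕ
  | 0 => trailBaseF
  | n + 1 => fun j m c l1 V L =>
      bif Nat.beq (n + 1) k then
        (lookT T j m c l1 L).getD (trailStepF n (trailCodeT k T n) j m c l1 V L)
      else trailStepF n (trailCodeT k T n) j m c l1 V L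

/-- Correctness of an oracle table at level `k`: every entry is a true value of `trailCode k`. [folklore] -/
def TValid (k : ℕ) (T : List (ℕ × ℕ × ℕ × ℕ × List ℕ × ℕ)) : Prop :=
  ∀ e ∈ T, trailCode k e.1 e.2.1 e.2.2.1 e.2.2.2.1 e.2.2.2.2.1 = e.2.2.2.2.2

/-- [folklore] -/
theorem tValid_nil (k : ℕ) : TValid k [] := fun e he => by simp at he

/-- [folklore] -/
theorem TValid.cons {k : ℕ} {T : List (ℕ × ℕ × ℕ × ℕ × List ℕ × ℕ)} {j m c l1 v : ℕ} {L : List ℕ}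
    (h : trailCode k j m c l1 L = v) (hT : TValid k T) : TValid k ((j, m, c, l1, L, v) :: T) := by
  intro e he
  rcases List.mem_cons.1 he with rfl | he
  · exact h
  · exact hT e he

/-- **`trailCodeT = trailCode`** under the filter invariant, for a valid table. [folklore] -/
theorem trailCodeT_eq (k : ℕ) (T : List (ℕ × ℕ × ℕ × ℕ × List ℕ × ℕ)) (hT : TValid k T) (n : ℕ) :
    ∀ (j m c l1 V : ℕ) (L : List ℕ), FInv V L → trailCodeT k T n j m c l1 V L = trailCode n j m c l1 L := by
  induction n with
  | zero =>
    intro j m c l1 V L hV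
    simp only [trailCodeT, trailCode, trailBaseF, trailBase, natBeq_eq_decide]
  | succ n ih =>
    intro j m c l1 V L hV
    have hs := trailStepF_eq n (trailCodeT k T n) ih j m c l1 V L hV
    simp only [trailCodeT]
    cases hk : Nat.beq (n + 1) k with
    | false => exact hs
    | true =>
      rw [cond_true]
      cases hl : lookT T j m c l1 L with
      | none => exact hs
      | some v =>
        rw [Option.getD_some]
        have := hT _ (mem_of_lookT_eq_some hl)
        rw [← Nat.eq_of_beq_eq_true hk] at this
        exact this.symm

/-- An inner node of a split evaluation: `trailCode n … L = trailCodeT k T n … (maskOf L) L` for a valid table.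
[folklore] -/
theorem trailCode_eq_trailCodeT {k : ℕ} {T : List (ℕ × ℕ × ℕ × ℕ × List ℕ × ℕ)} (hT : TValid k T)
    (n j m c l1 : ℕ) (L : List ℕ) : trailCode n j m c l1 L = trailCodeT k T n j m c l1 (maskOf L) L :=
  (trailCodeT_eq k T hT n j m c l1 _ L (fInv_maskOf L)).symm

/-- The root of a split evaluation: `trailCodeF n … 0 [] = trailCodeT k T n … 0 []` for a valid table. [folklore] -/
theorem trailCodeF_eq_trailCodeT {k : ℕ} {T : List (ℕ × ℕ × ℕ × ℕ × List ℕ × ℕ)} (hT : TValid k T)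
    (n j m c l1 : ℕ) : trailCodeF n j m c l1 0 [] = trailCodeT k T n j m c l1 0 [] := by
  rw [trailCodeF_eq n j m c l1 0 [] fInv_nil, trailCodeT_eq k T hT n j m c l1 0 [] fInv_nil]

/-! ### The code of a bond -/

/-- Bond codes are injective in (point code, direction) for directions `< sawB`. [folklore] -/
theorem bondCode_inj {c c' i i' : ℕ} (hi : i < sawB) (hi' : i' < sawB) (h : bondCode c i = bondCode c' i') :
    c = c' ∧ i = i' := by
  simp only [bondCode, sawB] at h hi hi'
  omega

/-- `bvec` is injective on indices `< d`. [folklore] -/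
theorem bvec_inj {i i' : ℕ} (hi : i < d) (h : bvec d i = bvec d i') : i = i' := by
  have := congr_fun h ⟨i, hi⟩
  by_contra hne
  simp [bvec, hne] at this

/-- Two unit coordinate vectors never cancel. [folklore] -/
theorem bvec_add_bvec_ne_zero {i : ℕ} (hi : i < d) (i' : ℕ) : bvec d i + bvec d i' ≠ 0 := by
  intro h
  have := congr_fun h ⟨i, hi⟩
  simp only [Pi.add_apply, bvec, if_true, Pi.zero_apply] at this
  split_ifs at this <;> omega

/-- The coded bond list `L` represents the bond set `E` (on `D` digits): the listed codes are exactly the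
codes `code(z) · 64 + i` of the bonds `{z, z + e_i} ∈ E` with `z` in the box and supported on the first `D`
coordinates, `i < D`. [folklore] -/
def BondRep (D : ℕ) (E : Finset (Sym2 (Site d))) (L : List ℕ) : Prop :=
  ∀ c, memL c L = true ↔ ∃ z : Site d, ∃ i : ℕ, i < D ∧ i < d ∧ InBox z ∧ SuppBelow D z ∧
    s(z + bvec d i, z) ∈ E ∧ c = bondCode (code D z) i

/-- The empty list represents the empty bond set. [folklore] -/
theorem bondRep_nil (D : ℕ) : BondRep D (∅ : Finset (Sym2 (Site d))) [] := by
  intro c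
  simp [memL]

/-- **Membership test by code**: for a box point `z` supported on the first `D ≤ 64` coordinates and `i < D`,
`bondCode (code D z) i` is listed iff `{z, z + e_i} ∈ E`. [folklore] -/
theorem BondRep.mem_iff {D : ℕ} {E : Finset (Sym2 (Site d))} {L : List ℕ} (hL : BondRep D E L)
    (hD : D ≤ sawB) {z : Site d} {i : ℕ} (hiD : i < D) (hid : i < d) (hz : InBox z) (hzD : SuppBelow D z) :
    memL (bondCode (code D z) i) L = true ↔ s(z + bvec d i, z) ∈ E := by
  rw [hL]
  constructor
  · rintro ⟨z', i', hi'D, -, hz', hz'D, hmem, hc⟩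
    obtain ⟨hcc, rfl⟩ := bondCode_inj (by omega) (by omega) hc
    rw [code_inj hz hz' hzD hz'D hcc]
    exact hmem
  · exact fun h => ⟨z, i, hiD, hid, hz, hzD, h, rfl⟩

/-- **Recording a bond**: consing the code of the new bond `{z, z + e_i}` represents `insert`. [folklore] -/
theorem BondRep.cons {D : ℕ} {E : Finset (Sym2 (Site d))} {L : List ℕ} (hL : BondRep D E L)
    {z : Site d} {i : ℕ} (hiD : i < D) (hid : i < d) (hz : InBox z) (hzD : SuppBelow D z) :
    BondRep D (insert s(z + bvec d i, z) E) (bondCode (code D z) i :: L) := by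
  intro c
  rw [memL, Bool.or_eq_true, Nat.beq_eq, hL]
  constructor
  · rintro (rfl | ⟨z', i', hi'D, hi'd, hz', hz'D, hmem, hc⟩)
    · exact ⟨z, i, hiD, hid, hz, hzD, mem_insert_self _ _, rfl⟩
    · exact ⟨z', i', hi'D, hi'd, hz', hz'D, mem_insert_of_mem hmem, hc⟩
  · rintro ⟨z', i', hi'D, hi'd, hz', hz'D, hmem, hc⟩
    rcases mem_insert.1 hmem with heq | hmem
    · left
      rcases Sym2.eq_iff.1 heq with ⟨h1, h2⟩ | ⟨h1, h2⟩
      · subst h2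
        rw [hc, bvec_inj hi'd (add_left_cancel h1)]
      · subst h2
        rw [add_assoc, add_eq_left] at h1
        exact absurd h1 (bvec_add_bvec_ne_zero hid i')
    · exact Or.inr ⟨z', i', hi'D, hi'd, hz', hz'D, hmem, hc⟩

/-- The bond `{y - e_i, y}` in lower-end-point form. [folklore] -/
theorem sym2_sub_bvec (y : Site d) (i : ℕ) : s(y - bvec d i, y) = s(y - bvec d i + bvec d i, y - bvec d i) := by
  rw [sub_add_cancel, Sym2.eq_swap]

/-! ### The transfer theorem -/

/-- **Transfer**: the coded recursion computes `trailCount`, uniformly in `d`.  For `y`, `E` supported on the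
first `m ≤ d` coordinates, inside the box with margin `n`, `D ≤ 64` digits with `m + n ≤ D`, and `L`
representing `E`:
`trailCount d n y E = Σ_{j ≤ n} trailCode n j m (code D y) ‖y‖₁ L · 2^j (d-m)^{(j)}`. [folklore] -/
theorem trailCount_eq_sum_trailCode (D : ℕ) (hDB : D ≤ sawB) (n : ℕ) :
    ∀ (m : ℕ) (y : Site d) (E : Finset (Sym2 (Site d))) (L : List ℕ),
      m ≤ d → SuppBelow m y → BondsSuppBelow m E → m + n ≤ D →
      (∀ i : Fin d, (y i).natAbs + n < sawR) → BondRep D E L →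
      trailCount d n y E =
        ∑ j ∈ range (n + 1), trailCode n j m (code D y) (l1Norm y) L * freshWeight d m j := by
  induction n with
  | zero =>
    intro m y E L hmd hy hE hmD hbox hL
    rw [sum_range_one, freshWeight_zero, mul_one, trailCode_zero, trailCount_zero, zero_add]
    simp only [l1Norm_eq_zero_iff]
  | succ n ih =>
    intro m y E L hmd hy hE hmD hbox hL
    have hyBox : InBox y := fun i => by have := hbox i; omega
    have hbox1 : ∀ i : Fin d, (y i).natAbs + 1 < sawR := fun i => by have := hbox i; omega
    have hmD' : m < D := by omega
    have hyD : SuppBelow D y := hy.mono hmD'.le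
    -- the semantic children, in coded form
    let p : ℕ → ℕ → ℕ := fun i j =>
      if s(y + bvec d i, y) ∈ E then 0 else
        trailCode n j m (code D (y + bvec d i)) (l1Norm (y + bvec d i)) (bondCode (code D y) i :: L)
    let q : ℕ → ℕ → ℕ := fun i j =>
      if s(y - bvec d i, y) ∈ E then 0 else
        trailCode n j m (code D (y - bvec d i)) (l1Norm (y - bvec d i))
          (bondCode (code D (y - bvec d i)) i :: L)
    let f : ℕ → ℕ := fun j =>
      trailCode n j (m + 1) (code D y + sawB ^ m) (l1Norm y + 1) (bondCode (code D y) m :: L)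
    have hp_def : ∀ i j, p i j = if s(y + bvec d i, y) ∈ E then 0 else
        trailCode n j m (code D (y + bvec d i)) (l1Norm (y + bvec d i)) (bondCode (code D y) i :: L) :=
      fun _ _ => rfl
    have hq_def : ∀ i j, q i j = if s(y - bvec d i, y) ∈ E then 0 else
        trailCode n j m (code D (y - bvec d i)) (l1Norm (y - bvec d i))
          (bondCode (code D (y - bvec d i)) i :: L) :=
      fun _ _ => rfl
    -- the list invariant for the children
    have hLp : ∀ i < m, BondRep D (insert s(y + bvec d i, y) E) (bondCode (code D y) i :: L) :=
      fun i hi => hL.cons (by omega) (by omega) hyBox hyD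
    have hLq : ∀ i < m,
        BondRep D (insert s(y - bvec d i, y) E) (bondCode (code D (y - bvec d i)) i :: L) := by
      intro i hi
      rw [sym2_sub_bvec]
      exact hL.cons (by omega) (by omega) (inBox_sub_bvec hbox1 i) ((hy.sub_bvec hi).mono hmD'.le)
    -- membership tests by code
    have hmem_p : ∀ i < m, (memL (bondCode (code D y) i) L = true ↔ s(y + bvec d i, y) ∈ E) :=
      fun i hi => hL.mem_iff hDB (by omega) (by omega) hyBox hyD
    have hmem_q : ∀ i < m,
        (memL (bondCode (code D y - sawB ^ i) i) L = true ↔ s(y - bvec d i, y) ∈ E) := by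
      intro i hi
      rw [← code_sub_bvec hyBox (show i < D by omega) (show i < d by omega),
        hL.mem_iff hDB (by omega) (by omega) (inBox_sub_bvec hbox1 i) ((hy.sub_bvec hi).mono hmD'.le),
        ← sym2_sub_bvec]
    -- IH for the active children
    have hP : ∀ i ∈ range m,
        (if s(y + bvec d i, y) ∈ E then 0
          else trailCount d n (y + bvec d i) (insert s(y + bvec d i, y) E)) =
          ∑ j ∈ range (n + 1), p i j * freshWeight d m j := by
      intro i hi
      rw [mem_range] at hi
      by_cases hb : s(y + bvec d i, y) ∈ E
      · rw [if_pos hb]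
        symm
        refine sum_eq_zero fun j _ => ?_
        rw [hp_def, if_pos hb, zero_mul]
      · rw [if_neg hb, ih m _ _ _ hmd (hy.add_bvec hi) (hE.insert (hy.add_bvec hi) hy) (by omega)
          (margin_add_bvec hbox i) (hLp i hi)]
        refine sum_congr rfl fun j _ => ?_
        rw [hp_def, if_neg hb]
    have hQ : ∀ i ∈ range m,
        (if s(y - bvec d i, y) ∈ E then 0
          else trailCount d n (y - bvec d i) (insert s(y - bvec d i, y) E)) =
          ∑ j ∈ range (n + 1), q i j * freshWeight d m j := by
      intro i hi
      rw [mem_range] at hi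
      by_cases hb : s(y - bvec d i, y) ∈ E
      · rw [if_pos hb]
        symm
        refine sum_eq_zero fun j _ => ?_
        rw [hq_def, if_pos hb, zero_mul]
      · rw [if_neg hb, ih m _ _ _ hmd (hy.sub_bvec hi) (hE.insert (hy.sub_bvec hi) hy) (by omega)
          (margin_sub_bvec hbox i) (hLq i hi)]
        refine sum_congr rfl fun j _ => ?_
        rw [hq_def, if_neg hb]
    -- the key identity per `j`: the coded step equals the (semantic) active children + the coded fresh child
    have key : ∀ j, trailCode (n + 1) j m (code D y) (l1Norm y) L =
        (∑ i ∈ range m, (p i j + q i j)) + (if j = 0 then 0 else f (j - 1)) := by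
      intro j
      by_cases hp : n + 1 < 2 * j + l1Norm y ∨ (n + 1 + l1Norm y) % 2 = 1
      · rw [trailCode_prune hp]
        symm
        rw [Nat.add_eq_zero_iff]
        refine ⟨sum_eq_zero fun i hi => ?_, ?_⟩
        · rw [mem_range] at hi
          have hid : i < d := by omega
          have h1 := l1Norm_sub_stepVec (y + bvec d i) (⟨i, hid⟩, true)
          have h2 := l1Norm_sub_stepVec (y - bvec d i) (⟨i, hid⟩, false)
          rw [stepVec_true] at h1
          rw [stepVec_false, sub_neg_eq_add] at h2
          have e1 : y + bvec d i - bvec d i = y := add_sub_cancel_right y _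
          have e2 : y - bvec d i + bvec d i = y := sub_add_cancel y _
          simp only [e1, e2] at h1 h2
          rw [hp_def, hq_def, Nat.add_eq_zero_iff]
          constructor
          · split_ifs
            · rfl
            · exact trailCode_prune (by omega)
          · split_ifs
            · rfl
            · exact trailCode_prune (by omega)
        · split_ifs with hj
          · rfl
          · exact trailCode_prune (by omega)
      · rw [trailCode_succ n hp]
        congr 1
        refine sum_congr rfl fun i hi => ?_
        rw [mem_range] at hi
        have hid : i < d := by omega
        have hiD : i < D := by omega
        rw [hp_def, hq_def]
        congr 1
        · by_cases hb : s(y + bvec d i, y) ∈ E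
          · rw [if_pos ((hmem_p i hi).2 hb), if_pos hb]
          · rw [if_neg (fun h => hb ((hmem_p i hi).1 h)), if_neg hb, code_add_bvec hyBox hiD hid,
              l1Norm_add_bvec hyBox hiD hid]
        · by_cases hb : s(y - bvec d i, y) ∈ E
          · rw [if_pos ((hmem_q i hi).2 hb), if_pos hb]
          · rw [if_neg (fun h => hb ((hmem_q i hi).1 h)), if_neg hb, code_sub_bvec hyBox hiD hid,
              l1Norm_sub_bvec hyBox hiD hid]
    -- assemble
    rw [trailCount_succ_of_suppBelow hmd n hy hE]
    have hR : ∑ j ∈ range (n + 1 + 1), trailCode (n + 1) j m (code D y) (l1Norm y) L * freshWeight d m j =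
        (∑ j ∈ range (n + 1 + 1), (∑ i ∈ range m, (p i j + q i j)) * freshWeight d m j) +
          ∑ j ∈ range (n + 1 + 1), (if j = 0 then 0 else f (j - 1)) * freshWeight d m j := by
      rw [← sum_add_distrib]
      exact sum_congr rfl fun j _ => by rw [key, add_mul]
    rw [hR]
    congr 1
    · -- active coordinates
      have hlast : (∑ i ∈ range m, (p i (n + 1) + q i (n + 1))) * freshWeight d m (n + 1) = 0 := by
        rw [sum_eq_zero, zero_mul]
        intro i _
        rw [hp_def, hq_def, Nat.add_eq_zero_iff]
        constructor
        · split_ifs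
          · rfl
          · exact trailCode_prune (by omega)
        · split_ifs
          · rfl
          · exact trailCode_prune (by omega)
      rw [sum_range_succ, hlast, add_zero,
        sum_congr rfl fun i hi => congrArg₂ (· + ·) (hP i hi) (hQ i hi)]
      simp_rw [sum_mul]
      rw [sum_comm (s := range (n + 1))]
      refine sum_congr rfl fun i _ => ?_
      rw [← sum_add_distrib]
      refine sum_congr rfl fun j _ => ?_
      ring
    · -- the fresh coordinate
      have hY : ∑ j ∈ range (n + 1 + 1), (if j = 0 then 0 else f (j - 1)) * freshWeight d m j =
          ∑ j ∈ range (n + 1), f j * freshWeight d m (j + 1) := by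
        rw [sum_range_succ']
        simp
      rw [hY]
      simp_rw [← freshWeight_succ d m]
      by_cases hmd2 : m < d
      · rw [ih (m + 1) _ _ _ hmd2 hy.add_bvec_succ
            ((hE.mono (Nat.le_succ m)).insert hy.add_bvec_succ (hy.mono (Nat.le_succ m))) (by omega)
            (margin_add_bvec hbox m) (hL.cons hmD' hmd2 hyBox hyD), code_add_bvec hyBox hmD' hmd2,
          l1Norm_add_bvec_fresh hy hmd2, mul_sum]
        refine sum_congr rfl fun j _ => ?_
        ring
      · have h0 : d - m = 0 := by omega
        simp [h0]

/-- **The trail counts are polynomials in `d`, coefficientwise kernel-evaluable.**  For `x` supported on the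
first `s ≤ d` coordinates with `|x_i| + n < 32` and `s + n ≤ 64`:
`#trailWordsTo d n x = Σ_{j ≤ n} trailCode n j s (code (s + n) x) ‖x‖₁ [] · 2^j (d - s)^{(j)}`
(reproduces the shape of SRW.nb §3 `nrBAW[n,d,x]`). [folklore] -/
theorem card_trailWordsTo_eq_sum_trailCode (n s : ℕ) (hsd : s ≤ d) (x : Site d) (hx : SuppBelow s x)
    (hbox : ∀ i : Fin d, (x i).natAbs + n < sawR) (hsn : s + n ≤ sawB) :
    (trailWordsTo d n x).card =
      ∑ j ∈ range (n + 1), trailCode n j s (code (s + n) x) (l1Norm x) [] * freshWeight d s j := by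
  rw [card_trailWordsTo_eq_trailCount]
  exact trailCount_eq_sum_trailCode (s + n) hsn n s x ∅ [] hsd hx (bondsSuppBelow_empty s) le_rfl hbox
    (bondRep_nil (s + n))

end Literature.Probability.FitznerVanDerHofstad2017
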